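import Mathlib
import HarnessLib
import Literature.Analysis.FluidPDE.TypeIAncientMildClassical
import Literature.Analysis.FluidPDE.WholeSpaceIBP
import Literature.Analysis.FluidPDE.MildSolutionProofs
import Summits.NavierStokesRegularity.NavierStokesRegularity.Theorems.PoloidalWindowDoorPoloidalWindowRigidityLargeScaleEnergyBootstrap
import Summits.NavierStokesRegularity.NavierStokesRegularity.Theorems.PoloidalWindowDoorPoloidalWindowRigidityLargeScaleEnergyBootstrapScaling
import Summits.NavierStokesRegularity.NavierStokesRegularity.Theorems.PoloidalWindowDoorPoloidalWindowRigidityLargeScaleEnergyPressure32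
import Summits.NavierStokesRegularity.NavierStokesRegularity.Theorems.PoloidalWindowDoorPoloidalWindowRigidityLargeScaleEnergyDecay
import Summits.NavierStokesRegularity.NavierStokesRegularity.Theorems.PoloidalWindowDoorPoloidalWindowRigidityZoomOut
import Summits.NavierStokesRegularity.NavierStokesRegularity.Theorems.PoloidalWindowDoorPoloidalWindowRigidityWindow

/-!
# Route `PoloidalWindowDoor`, crux `PoloidalWindowRigidity` (K2, stmt-NavierStokesRegularity-19708) — whole-class theorem:
# THE LARGE-SCALE ENERGY BOOTSTRAP OF THE TYPE-I MILD CLASS, UNCONDITIONAL —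
# `∫_{B̄(0,R)} ‖v(t)‖² ≤ K_α R^α (−t)^{−(α−1)/2}` for EVERY `α > 3/2`

Cell ns-regularity-ideate, seat ns-poloidal-K2-p3 gen 3 (stub-worker under the K2 lead ns-poloidal-K2-p1 g3, LEAD LINE #1
(2); file landed `--supports stmt-NavierStokesRegularity-19708` as a helper).  K2 lead's programme K2P1-M11-NOTES §5
(«BOOTSTRAP expected»); refuter1 K-29: the next residue clause must CONSUME the mild identity (M), and an energy clause
at the `K·R²` level does not cut the SHEET stratum of the `(M) ↦ ClassRates` witnesses — a level `R^α`, `α < 2`, does.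

For a profile `v` of the route's Type-I class (rate `‖v(t,x)‖ ≤ C/√(−t)`, continuous on the open slab, unit-viscosity
Oseen-mild between negative times, divergence-free slices) write LEVEL `α` (constant `K`) for
  `∀ t < 0, ∀ R > 0:  ∫_{B̄(0,R)} ‖v(t,x)‖² dx ≤ K · R^α · (−t)^{−(α−1)/2}`
(scale-invariant; `α = 3` is the bare Type-I rate, `α = 1` the scale-invariant floor).  This file proves:
* `class_zoom₀` — the class is invariant under the parabolic zooms `v ↦ c v(c²·, c·)` (tree `class_zoom`);
* `levelTwo_at_neg_one`, `exists_levelTwo` — **LEVEL 2** for every profile (nsreg-p7 g5's `energy_ball_le` on the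
  ancient window `[−R², −1]` + nsreg-p7 g6's (F1) `exists_integral_abs_sub_le_class`, `log R ≤ R`; transport to all
  `t` by `level_of_level_at_neg_one`, small radii by `setIntegral_closedBall_norm_sq_le_of_small`) — the K2 lead's
  `R²/√(−t)` law, now with no hypothesis;
* `levelStep_at_neg_one`, `levelStep` — **LEVEL `α` ⇒ LEVEL `1 + α/3`** (`1 < α < 3`): `energy_ball_le_of_level` +
  the `L^{3/2}` class pressure bound `exists_integral_rpow_sub_le_class` + zoom invariance of the levels;
* `exists_level_five_thirds` — LEVEL `5/3` (one step; the concrete clause offered for rev 12 of the K2 skeleton);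
* `exists_level_of_gt_three_halves` — **LEVEL `α` FOR EVERY `3/2 < α ≤ 3`** (iterate `α ↦ 1 + α/3` from `2`:
  `α_n = 3/2 + (1/2)3^{−n} ↓ 3/2`, then monotonicity `level_mono`).
So Type-I mild profiles are «thinner than sheets» in `L²` density on every slice: `∫_{B̄_R}‖v(t)‖² = O_ε(R^{3/2+ε})`
(sheets give `R²`, tubes `R¹`); with an `L²` (or any `L^q`, `q ≥ 2`) pressure oscillation bound the same scheme
reaches the floor `1⁺`.

WHAT THIS IS NOT: not a claim about Navier–Stokes regularity and not the open residue S2⁗ — an unconditional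
large-scale estimate for the whole Type-I mild class (bears_on LADDER-NS N0; also every route whose residue lives in
this class).
-/

noncomputable section

-- the summit and its single sub-problem share the name (CONVENTIONS §1), as in every Theorems file
set_option linter.dupNamespace false

namespace Summit.NavierStokesRegularity.NavierStokesRegularity.Theorems.PoloidalWindowDoorPoloidalWindowRigidityLargeScaleEnergyBootstrapLevels

open MeasureTheory Set Function Filter Topology Metric
open scoped RealInnerProductSpace
open Literature.Analysis Literature.Analysis.FluidPDE Literature.Analysis.UnboundedOperators
open Summit.NavierStokesRegularity.NavierStokesRegularity.Theorems.PoloidalWindowDoorPoloidalWindowRigidityLargeScaleEnergyBootstrap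
open Summit.NavierStokesRegularity.NavierStokesRegularity.Theorems.PoloidalWindowDoorPoloidalWindowRigidityLargeScaleEnergyBootstrapScaling
open Summit.NavierStokesRegularity.NavierStokesRegularity.Theorems.PoloidalWindowDoorPoloidalWindowRigidityLargeScaleEnergyPressure32
open Summit.NavierStokesRegularity.NavierStokesRegularity.Theorems.PoloidalWindowDoorPoloidalWindowRigidityLargeScaleEnergyDecay
  (energy_ball_le)
open Summit.NavierStokesRegularity.NavierStokesRegularity.Theorems.PoloidalWindowDoorPoloidalWindowRigidityPressureOscillation
  (exists_integral_abs_sub_le_class)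
open Summit.NavierStokesRegularity.NavierStokesRegularity.Theorems.PoloidalWindowDoorPoloidalWindowRigidityZoomOut (class_zoom)
open Summit.NavierStokesRegularity.NavierStokesRegularity.Theorems.PoloidalWindowDoorPoloidalWindowRigidityWindow
  (isTypeIAncientMild_of_class)

variable {C : ℝ} {v : ℝ → EuclideanSpace ℝ (Fin 3) → EuclideanSpace ℝ (Fin 3)}

/-! ### The class under parabolic zooms about the origin -/

/-- **The class is invariant under the parabolic zooms `v ↦ c v(c²·, c·)`** (`c > 0`): the tree's `class_zoom` with
centre `0`. -/
theorem class_zoom₀ (hrate : HasTypeITimeDecay C v)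
    (hcont : ContinuousOn (uncurry v) (Iio (0 : ℝ) ×ˢ univ))
    (hmild : ∀ s t : ℝ, s < t → t < 0 → ∀ x,
      v t x = heatExtension (v s) (t - s) x - oseenDuhamel 1 s v v t x)
    (hdiv : ∀ t < 0, VectorCalculus.IsDivFree (v t)) {c : ℝ} (hc : 0 < c) :
    HasTypeITimeDecay C (fun s y => c • v (c ^ 2 * s) (c • y)) ∧
    ContinuousOn (uncurry fun s y => c • v (c ^ 2 * s) (c • y)) (Iio (0 : ℝ) ×ˢ univ) ∧
    (∀ s t : ℝ, s < t → t < 0 → ∀ x, (fun s y => c • v (c ^ 2 * s) (c • y)) t x =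
      heatExtension ((fun s y => c • v (c ^ 2 * s) (c • y)) s) (t - s) x -
        oseenDuhamel 1 s (fun s y => c • v (c ^ 2 * s) (c • y)) (fun s y => c • v (c ^ 2 * s) (c • y)) t x) ∧
    (∀ t < 0, VectorCalculus.IsDivFree ((fun s y => c • v (c ^ 2 * s) (c • y)) t)) := by
  have h := class_zoom hrate hcont hmild hdiv hc 0
  have e : (fun s y => c • v (c ^ 2 * s) ((0 : EuclideanSpace ℝ (Fin 3)) + c • y)) =
      fun s y => c • v (c ^ 2 * s) (c • y) := by
    funext s y; rw [zero_add]
  rw [e] at h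
  exact h

/-- The Type-I constant of a profile is nonnegative. -/
theorem typeI_const_nonneg (hrate : HasTypeITimeDecay C v) : 0 ≤ C := by
  have h := hrate (-1) (by norm_num) 0
  rw [neg_neg, Real.sqrt_one, div_one] at h
  exact (norm_nonneg _).trans h

/-- From the open to the closed ball (the sphere is null). [folklore] -/
theorem setIntegral_closedBall_eq_ball (f : EuclideanSpace ℝ (Fin 3) → ℝ) (R : ℝ) :
    ∫ x in closedBall (0 : EuclideanSpace ℝ (Fin 3)) R, f x = ∫ x in ball (0 : EuclideanSpace ℝ (Fin 3)) R, f x :=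
  setIntegral_congr_set (closedBall_ae_eq_ball_three 0 R)

/-! ### LEVEL 2 -/

/-- **LEVEL 2 at time `−1`.**  There is `K₂ = K₂(C) ≥ 0` such that every profile of the class with rate `C` satisfies
`∫_{B̄(0,R)} ‖v(−1)‖² ≤ K₂ R²` for all `R ≥ 1` (p7 g5's `energy_ball_le` on `[−R², −1]` with p7 g6's (F1) at radius
`2R ≥ 1`; `log R² ≤ 2R`). -/
theorem levelTwo_at_neg_one (C : ℝ) (hC0 : 0 ≤ C) : ∃ K₂ : ℝ, 0 ≤ K₂ ∧
    ∀ v : ℝ → EuclideanSpace ℝ (Fin 3) → EuclideanSpace ℝ (Fin 3), HasTypeITimeDecay C v →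
      ContinuousOn (uncurry v) (Iio (0 : ℝ) ×ˢ univ) →
      (∀ s t : ℝ, s < t → t < 0 → ∀ x, v t x = heatExtension (v s) (t - s) x - oseenDuhamel 1 s v v t x) →
      (∀ t < 0, VectorCalculus.IsDivFree (v t)) →
      ∀ R : ℝ, 1 ≤ R → ∫ x in closedBall (0 : EuclideanSpace ℝ (Fin 3)) R, ‖v (-1) x‖ ^ 2 ≤ K₂ * R ^ (2 : ℝ) := by
  obtain ⟨C₁, hC₁0, hC₁⟩ := exists_norm_fderiv_cutoff_le (E := EuclideanSpace ℝ (Fin 3))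
  obtain ⟨C₂, hC₂0, hC₂⟩ := exists_abs_laplacian_cutoff_le (E := EuclideanSpace ℝ (Fin 3))
  obtain ⟨KF, hKF0, hF1⟩ := exists_integral_abs_sub_le_class
  set V₁ : ℝ := volume.real (closedBall (0 : EuclideanSpace ℝ (Fin 3)) 1) with hV₁
  have hV₁0 : 0 ≤ V₁ := measureReal_nonneg
  set A : ℝ := KF * C ^ 2 with hA
  have hA0 : 0 ≤ A := by positivity
  refine ⟨8 * V₁ * (C ^ 2 + 2 * C₂ * C ^ 2 + 2 * C₁ * (C ^ 3 + 2 * C * A)), by positivity, ?_⟩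
  intro v hrate hcont hmild hdiv R hR
  have hR0 : 0 < R := by linarith
  have hAM : IsTypeIAncientMild C v := isTypeIAncientMild_of_class hrate hcont hmild hdiv
  -- a window carrying a classical pressure
  have hwin : -R ^ 2 - 1 < 0 := by nlinarith
  obtain ⟨p, hp⟩ := hAM.exists_isClassicalNSSolutionOn_Ioo hwin
  have h12 : -R ^ 2 ≤ (-1 : ℝ) := by nlinarith
  have hI : Icc (-R ^ 2) (-1) ⊆ Ioo (-R ^ 2 - 1) 0 := fun s hs => ⟨by linarith [hs.1], by linarith [hs.2]⟩
  have hC : ∀ s ∈ Icc (-R ^ 2) (-1), ∀ x, ‖v s x‖ ≤ C / Real.sqrt (-s) := fun s hs x =>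
    hrate s (by linarith [hs.2]) x
  have hosc : ∀ s ∈ Icc (-R ^ 2) (-1), ∃ c : ℝ,
      ∫ x in closedBall (0 : EuclideanSpace ℝ (Fin 3)) (2 * R), |p s x - c| ≤
        A / (-s) * volume.real (closedBall (0 : EuclideanSpace ℝ (Fin 3)) (2 * R)) := by
    intro s hs
    obtain ⟨κ, hκ⟩ := hF1 hrate hmild hwin hp s (hI hs) 0 (2 * R) (by linarith)
    refine ⟨κ, hκ.trans (le_of_eq ?_)⟩
    rw [hA]; ring
  have h := energy_ball_le hp isOpen_Ioo h12 (by norm_num) hI hC0 hA0 hR0 hC hosc (hC₁ R hR0) (hC₂ R hR0)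
  -- simplify the right-hand side at `t₂ = −1`, `t₁ = −R²`
  rw [neg_neg, neg_neg, Real.sqrt_one, mul_one, show (-R ^ 2 / -1 : ℝ) = R ^ 2 by ring,
    volumeReal_closedBall_two_mul hR0.le] at h
  rw [setIntegral_closedBall_eq_ball]
  refine h.trans ?_
  have hlog : Real.log (R ^ 2) ≤ 2 * R := by
    rw [Real.log_pow]; push_cast
    linarith [Real.log_le_sub_one_of_pos hR0]
  have hR1 : R ≤ R ^ 2 := by nlinarith
  rw [Real.rpow_two]
  -- termwise: `(2R)³ C²/R² = 8C²R ≤ 8C²R²`, `(2R)³ C₂C² log R²/R² ≤ 16 C₂C² R²`, `(2R)³·2C₁(…)/R = 16 C₁(…) R²`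
  have hK : 0 ≤ C ^ 3 + 2 * C * A := by positivity
  rw [← hV₁]
  have e1 : (2 * R) ^ 3 * V₁ * (C ^ 2 / R ^ 2 + C₂ * C ^ 2 * Real.log (R ^ 2) / R ^ 2 +
      2 * C₁ * (C ^ 3 + 2 * C * A) / R) =
      8 * V₁ * (C ^ 2 * R + C₂ * C ^ 2 * (R * Real.log (R ^ 2)) + 2 * C₁ * (C ^ 3 + 2 * C * A) * R ^ 2) := by
    field_simp
    ring
  rw [e1]
  have h2 : R * Real.log (R ^ 2) ≤ 2 * R ^ 2 := by nlinarith
  have h3 : C ^ 2 * R + C₂ * C ^ 2 * (R * Real.log (R ^ 2)) + 2 * C₁ * (C ^ 3 + 2 * C * A) * R ^ 2 ≤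
      (C ^ 2 + 2 * C₂ * C ^ 2 + 2 * C₁ * (C ^ 3 + 2 * C * A)) * R ^ 2 := by
    nlinarith [mul_le_mul_of_nonneg_left hR1 (sq_nonneg C), mul_le_mul_of_nonneg_left h2 (by positivity : 0 ≤ C₂ * C ^ 2)]
  calc 8 * V₁ * (C ^ 2 * R + C₂ * C ^ 2 * (R * Real.log (R ^ 2)) + 2 * C₁ * (C ^ 3 + 2 * C * A) * R ^ 2)
      ≤ 8 * V₁ * ((C ^ 2 + 2 * C₂ * C ^ 2 + 2 * C₁ * (C ^ 3 + 2 * C * A)) * R ^ 2) :=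
        mul_le_mul_of_nonneg_left h3 (by positivity)
    _ = 8 * V₁ * (C ^ 2 + 2 * C₂ * C ^ 2 + 2 * C₁ * (C ^ 3 + 2 * C * A)) * R ^ 2 := by ring

/-- **LEVEL 2 (unconditional).**  For every profile of the route's Type-I class there is `K ≥ 0` with
`∫_{B̄(0,R)} ‖v(t)‖² ≤ K R² (−t)^{−1/2}` for all `t < 0`, `R > 0` (the K2 lead's «Type-I profiles are at most
sheet-like in `L²` density», K2P1-M11-NOTES §5, now a theorem of the class). -/
theorem exists_levelTwo (hrate : HasTypeITimeDecay C v)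
    (hcont : ContinuousOn (uncurry v) (Iio (0 : ℝ) ×ˢ univ))
    (hmild : ∀ s t : ℝ, s < t → t < 0 → ∀ x,
      v t x = heatExtension (v s) (t - s) x - oseenDuhamel 1 s v v t x)
    (hdiv : ∀ t < 0, VectorCalculus.IsDivFree (v t)) :
    ∃ K : ℝ, 0 ≤ K ∧ ∀ t < 0, ∀ R : ℝ, 0 < R →
      ∫ x in closedBall (0 : EuclideanSpace ℝ (Fin 3)) R, ‖v t x‖ ^ 2 ≤ K * R ^ (2 : ℝ) * (-t) ^ (-(((2 : ℝ) - 1) / 2)) := by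
  have hC0 := typeI_const_nonneg hrate
  obtain ⟨K₂, hK₂0, H⟩ := levelTwo_at_neg_one C hC0
  set V₁ : ℝ := volume.real (closedBall (0 : EuclideanSpace ℝ (Fin 3)) 1) with hV₁
  have hV₁0 : 0 ≤ V₁ := measureReal_nonneg
  refine ⟨K₂ + C ^ 2 * V₁, by positivity, fun t ht R hR => ?_⟩
  have hX : 0 ≤ R ^ (2 : ℝ) * (-t) ^ (-(((2 : ℝ) - 1) / 2)) :=
    mul_nonneg (Real.rpow_nonneg hR.le _) (Real.rpow_nonneg (by linarith) _)
  rcases le_or_gt (Real.sqrt (-t)) R with hle | hlt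
  · -- large radii: transport the bound at `t = −1`
    have h := level_of_level_at_neg_one
      (P := fun w => HasTypeITimeDecay C w ∧ ContinuousOn (uncurry w) (Iio (0 : ℝ) ×ˢ univ) ∧
        (∀ s t : ℝ, s < t → t < 0 → ∀ x, w t x = heatExtension (w s) (t - s) x - oseenDuhamel 1 s w w t x) ∧
        (∀ t < 0, VectorCalculus.IsDivFree (w t)))
      (fun w hw c hc => class_zoom₀ hw.1 hw.2.1 hw.2.2.1 hw.2.2.2 hc)
      (fun w hw R hR => H w hw.1 hw.2.1 hw.2.2.1 hw.2.2.2 R hR) ⟨hrate, hcont, hmild, hdiv⟩ ht hle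
    calc _ ≤ K₂ * R ^ (2 : ℝ) * (-t) ^ (-(((2 : ℝ) - 1) / 2)) := h
      _ ≤ (K₂ + C ^ 2 * V₁) * R ^ (2 : ℝ) * (-t) ^ (-(((2 : ℝ) - 1) / 2)) := by
          rw [mul_assoc, mul_assoc]; exact mul_le_mul_of_nonneg_right (by nlinarith) hX
  · -- small radii: the Type-I rate alone
    have h := setIntegral_closedBall_norm_sq_le_of_small hrate (α := 2) (by norm_num) ht hR hlt.le
    calc _ ≤ C ^ 2 * V₁ * R ^ (2 : ℝ) * (-t) ^ (-(((2 : ℝ) - 1) / 2)) := h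
      _ ≤ (K₂ + C ^ 2 * V₁) * R ^ (2 : ℝ) * (-t) ^ (-(((2 : ℝ) - 1) / 2)) := by
          rw [mul_assoc (K₂ + _), mul_assoc (C ^ 2 * V₁)]; exact mul_le_mul_of_nonneg_right (by linarith) hX

/-! ### LEVEL `α` ⇒ LEVEL `1 + α/3` -/

/-- **The bootstrap step at time `−1`.**  For `1 < α < 3`, `K₀ ≥ 0`, `C ≥ 0` there is `K' ≥ 0` such that every
profile of the class (rate `C`) at LEVEL `α` (constant `K₀`) satisfies `∫_{B̄(0,R)}‖v(−1)‖² ≤ K' R^{1+α/3}` for all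
`R ≥ 1` (`energy_ball_le_of_level` on `[−R², −1]` with the `L^{3/2}` class pressure bound at radius `2R ≥ 1`). -/
theorem levelStep_at_neg_one (C K₀ α : ℝ) (hC0 : 0 ≤ C) (hK0 : 0 ≤ K₀) (hα1 : 1 < α) (hα3 : α < 3) :
    ∃ K' : ℝ, 0 ≤ K' ∧
    ∀ v : ℝ → EuclideanSpace ℝ (Fin 3) → EuclideanSpace ℝ (Fin 3), HasTypeITimeDecay C v →
      ContinuousOn (uncurry v) (Iio (0 : ℝ) ×ˢ univ) →
      (∀ s t : ℝ, s < t → t < 0 → ∀ x, v t x = heatExtension (v s) (t - s) x - oseenDuhamel 1 s v v t x) →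
      (∀ t < 0, VectorCalculus.IsDivFree (v t)) →
      (∀ t < 0, ∀ R : ℝ, 0 < R → ∫ x in closedBall (0 : EuclideanSpace ℝ (Fin 3)) R, ‖v t x‖ ^ 2 ≤
        K₀ * R ^ α * (-t) ^ (-((α - 1) / 2))) →
      ∀ R : ℝ, 1 ≤ R → ∫ x in closedBall (0 : EuclideanSpace ℝ (Fin 3)) R, ‖v (-1) x‖ ^ 2 ≤ K' * R ^ (1 + α / 3) := by
  obtain ⟨C₁, hC₁0, hC₁⟩ := exists_norm_fderiv_cutoff_le (E := EuclideanSpace ℝ (Fin 3))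
  obtain ⟨C₂, hC₂0, hC₂⟩ := exists_abs_laplacian_cutoff_le (E := EuclideanSpace ℝ (Fin 3))
  obtain ⟨A₀, hA₀0, hP32⟩ := exists_integral_rpow_sub_le_class
  set V₁ : ℝ := volume.real (closedBall (0 : EuclideanSpace ℝ (Fin 3)) 1) with hV₁
  have hV₁0 : 0 ≤ V₁ := measureReal_nonneg
  set A : ℝ := A₀ * C ^ 2 with hA
  have hA0 : 0 ≤ A := by positivity
  have h3α : 0 < 3 - α := by linarith
  have hα0 : 0 < α := by linarith
  refine ⟨K₀ * 2 ^ α * (1 + C₂ * (2 / (3 - α))) +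
      4 * C₁ * V₁ ^ (2 / 3 : ℝ) * (C * K₀) ^ (1 / 3 : ℝ) * 2 ^ (α / 3) * (C ^ 2 + 2 * A) * (6 / α),
    by positivity, ?_⟩
  intro v hrate hcont hmild hdiv hL R hR
  have hR0 : 0 < R := by linarith
  have hAM : IsTypeIAncientMild C v := isTypeIAncientMild_of_class hrate hcont hmild hdiv
  have hwin : -R ^ 2 - 1 < 0 := by nlinarith
  obtain ⟨p, hp⟩ := hAM.exists_isClassicalNSSolutionOn_Ioo hwin
  have hI : Icc (-R ^ 2) (-1) ⊆ Ioo (-R ^ 2 - 1) 0 := fun s hs => ⟨by linarith [hs.1], by linarith [hs.2]⟩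
  have hC : ∀ s ∈ Icc (-R ^ 2) (-1), ∀ x, ‖v s x‖ ≤ C / Real.sqrt (-s) := fun s hs x =>
    hrate s (by linarith [hs.2]) x
  have hE : ∀ s ∈ Icc (-R ^ 2) (-1), ∫ x in closedBall (0 : EuclideanSpace ℝ (Fin 3)) (2 * R), ‖v s x‖ ^ 2 ≤
      K₀ * (2 * R) ^ α * (-s) ^ (-((α - 1) / 2)) := fun s hs => hL s (by linarith [hs.2]) (2 * R) (by linarith)
  have hosc : ∀ s ∈ Icc (-R ^ 2) (-1), ∃ c : ℝ,
      ∫ x in closedBall (0 : EuclideanSpace ℝ (Fin 3)) (2 * R), |p s x - c| ^ (3 / 2 : ℝ) ≤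
        (A / (-s)) ^ (3 / 2 : ℝ) * volume.real (closedBall (0 : EuclideanSpace ℝ (Fin 3)) (2 * R)) := by
    intro s hs
    obtain ⟨κ, hκ⟩ := hP32 hrate hmild hwin hp s (hI hs) 0 (2 * R) (by linarith)
    exact ⟨κ, by rw [hA]; exact hκ⟩
  have hRt : Real.sqrt (-(-1 : ℝ)) ≤ R := by rw [neg_neg, Real.sqrt_one]; exact hR
  have h := energy_ball_le_of_level hp isOpen_Ioo (by norm_num) hRt hI hC0 hA0 hK0 hα1 hα3 hC hE hosc
    (hC₁ R hR0) (hC₂ R hR0)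
  rw [neg_neg, Real.one_rpow, mul_one] at h
  rw [setIntegral_closedBall_eq_ball]
  exact h

/-- **LEVEL `α` ⇒ LEVEL `1 + α/3` (unconditional).**  If a profile of the class is at LEVEL `α` (`1 < α < 3`) then
it is at LEVEL `1 + α/3`: `∃ K' ≥ 0, ∀ t < 0, ∀ R > 0, ∫_{B̄(0,R)}‖v(t)‖² ≤ K' R^{1+α/3} (−t)^{−α/6}`. -/
theorem levelStep (hrate : HasTypeITimeDecay C v)
    (hcont : ContinuousOn (uncurry v) (Iio (0 : ℝ) ×ˢ univ))
    (hmild : ∀ s t : ℝ, s < t → t < 0 → ∀ x,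
      v t x = heatExtension (v s) (t - s) x - oseenDuhamel 1 s v v t x)
    (hdiv : ∀ t < 0, VectorCalculus.IsDivFree (v t)) {α K₀ : ℝ} (hα1 : 1 < α) (hα3 : α < 3) (hK0 : 0 ≤ K₀)
    (hL : ∀ t < 0, ∀ R : ℝ, 0 < R → ∫ x in closedBall (0 : EuclideanSpace ℝ (Fin 3)) R, ‖v t x‖ ^ 2 ≤
      K₀ * R ^ α * (-t) ^ (-((α - 1) / 2))) :
    ∃ K' : ℝ, 0 ≤ K' ∧ ∀ t < 0, ∀ R : ℝ, 0 < R →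
      ∫ x in closedBall (0 : EuclideanSpace ℝ (Fin 3)) R, ‖v t x‖ ^ 2 ≤
        K' * R ^ (1 + α / 3) * (-t) ^ (-(((1 + α / 3) - 1) / 2)) := by
  have hC0 := typeI_const_nonneg hrate
  obtain ⟨K', hK'0, H⟩ := levelStep_at_neg_one C K₀ α hC0 hK0 hα1 hα3
  set V₁ : ℝ := volume.real (closedBall (0 : EuclideanSpace ℝ (Fin 3)) 1) with hV₁
  have hV₁0 : 0 ≤ V₁ := measureReal_nonneg
  refine ⟨K' + C ^ 2 * V₁, by positivity, fun t ht R hR => ?_⟩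
  have hX : 0 ≤ R ^ (1 + α / 3) * (-t) ^ (-(((1 + α / 3) - 1) / 2)) :=
    mul_nonneg (Real.rpow_nonneg hR.le _) (Real.rpow_nonneg (by linarith) _)
  rcases le_or_gt (Real.sqrt (-t)) R with hle | hlt
  · -- large radii: transport; the property `class ∧ level α` is zoom-invariant
    have hPz : ∀ w : ℝ → EuclideanSpace ℝ (Fin 3) → EuclideanSpace ℝ (Fin 3),
        (HasTypeITimeDecay C w ∧ ContinuousOn (uncurry w) (Iio (0 : ℝ) ×ˢ univ) ∧
          (∀ s t : ℝ, s < t → t < 0 → ∀ x, w t x = heatExtension (w s) (t - s) x - oseenDuhamel 1 s w w t x) ∧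
          (∀ t < 0, VectorCalculus.IsDivFree (w t)) ∧
          (∀ t < 0, ∀ R : ℝ, 0 < R → ∫ x in closedBall (0 : EuclideanSpace ℝ (Fin 3)) R, ‖w t x‖ ^ 2 ≤
            K₀ * R ^ α * (-t) ^ (-((α - 1) / 2)))) →
        ∀ c : ℝ, 0 < c → (HasTypeITimeDecay C (fun s y => c • w (c ^ 2 * s) (c • y)) ∧
          ContinuousOn (uncurry fun s y => c • w (c ^ 2 * s) (c • y)) (Iio (0 : ℝ) ×ˢ univ) ∧
          (∀ s t : ℝ, s < t → t < 0 → ∀ x, (fun s y => c • w (c ^ 2 * s) (c • y)) t x =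
            heatExtension ((fun s y => c • w (c ^ 2 * s) (c • y)) s) (t - s) x -
              oseenDuhamel 1 s (fun s y => c • w (c ^ 2 * s) (c • y)) (fun s y => c • w (c ^ 2 * s) (c • y)) t x) ∧
          (∀ t < 0, VectorCalculus.IsDivFree ((fun s y => c • w (c ^ 2 * s) (c • y)) t)) ∧
          (∀ t < 0, ∀ R : ℝ, 0 < R →
            ∫ x in closedBall (0 : EuclideanSpace ℝ (Fin 3)) R, ‖(fun s y => c • w (c ^ 2 * s) (c • y)) t x‖ ^ 2 ≤
              K₀ * R ^ α * (-t) ^ (-((α - 1) / 2)))) := by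
      intro w hw c hc
      obtain ⟨h1, h2, h3, h4⟩ := class_zoom₀ hw.1 hw.2.1 hw.2.2.1 hw.2.2.2.1 hc
      refine ⟨h1, h2, h3, h4, fun t ht R hR => ?_⟩
      have hct : c ^ 2 * t < 0 := mul_neg_of_pos_of_neg (pow_pos hc 2) ht
      have hb := hw.2.2.2.2 (c ^ 2 * t) hct (c * R) (mul_pos hc hR)
      show ∫ x in closedBall (0 : EuclideanSpace ℝ (Fin 3)) R, ‖c • w (c ^ 2 * t) (c • x)‖ ^ 2 ≤ _
      rw [setIntegral_closedBall_norm_sq_zoom w hc t hR.le]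
      -- `c⁻¹ K₀ (cR)^α (c²(−t))^{−β} = K₀ R^α (−t)^{−β}` since `α − 2β − 1 = 0`
      have ht0 : 0 < -t := neg_pos.2 ht
      have e : c⁻¹ * (K₀ * (c * R) ^ α * (-(c ^ 2 * t)) ^ (-((α - 1) / 2))) =
          K₀ * R ^ α * (-t) ^ (-((α - 1) / 2)) := by
        rw [Real.mul_rpow hc.le hR.le, show (-(c ^ 2 * t)) = c ^ 2 * (-t) by ring,
          Real.mul_rpow (pow_nonneg hc.le 2) ht0.le, show (c ^ 2 : ℝ) = c ^ (2 : ℝ) by norm_cast,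
          ← Real.rpow_mul hc.le]
        have hcc : c⁻¹ * c ^ α * c ^ ((2 : ℝ) * -((α - 1) / 2)) = 1 := by
          rw [← Real.rpow_neg_one, ← Real.rpow_add hc, ← Real.rpow_add hc,
            show (-1 : ℝ) + α + 2 * -((α - 1) / 2) = 0 by ring, Real.rpow_zero]
        calc c⁻¹ * (K₀ * (c ^ α * R ^ α) * (c ^ ((2 : ℝ) * -((α - 1) / 2)) * (-t) ^ (-((α - 1) / 2))))
            = (c⁻¹ * c ^ α * c ^ ((2 : ℝ) * -((α - 1) / 2))) * (K₀ * R ^ α * (-t) ^ (-((α - 1) / 2))) := by ring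
          _ = K₀ * R ^ α * (-t) ^ (-((α - 1) / 2)) := by rw [hcc, one_mul]
      calc c⁻¹ * ∫ y in closedBall (0 : EuclideanSpace ℝ (Fin 3)) (c * R), ‖w (c ^ 2 * t) y‖ ^ 2
          ≤ c⁻¹ * (K₀ * (c * R) ^ α * (-(c ^ 2 * t)) ^ (-((α - 1) / 2))) :=
            mul_le_mul_of_nonneg_left hb (inv_nonneg.2 hc.le)
        _ = K₀ * R ^ α * (-t) ^ (-((α - 1) / 2)) := e
    have h := level_of_level_at_neg_one (K := K') (α := 1 + α / 3) hPz
      (fun w hw R hR => H w hw.1 hw.2.1 hw.2.2.1 hw.2.2.2.1 hw.2.2.2.2 R hR) ⟨hrate, hcont, hmild, hdiv, hL⟩ ht hle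
    calc _ ≤ K' * R ^ (1 + α / 3) * (-t) ^ (-(((1 + α / 3) - 1) / 2)) := h
      _ ≤ (K' + C ^ 2 * V₁) * R ^ (1 + α / 3) * (-t) ^ (-(((1 + α / 3) - 1) / 2)) := by
          rw [mul_assoc, mul_assoc]; exact mul_le_mul_of_nonneg_right (by nlinarith) hX
  · have h := setIntegral_closedBall_norm_sq_le_of_small hrate (α := 1 + α / 3) (by linarith) ht hR hlt.le
    calc _ ≤ C ^ 2 * V₁ * R ^ (1 + α / 3) * (-t) ^ (-(((1 + α / 3) - 1) / 2)) := h
      _ ≤ (K' + C ^ 2 * V₁) * R ^ (1 + α / 3) * (-t) ^ (-(((1 + α / 3) - 1) / 2)) := by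
          rw [mul_assoc (K' + _), mul_assoc (C ^ 2 * V₁)]; exact mul_le_mul_of_nonneg_right (by linarith) hX

/-! ### The levels: `5/3`, and every `α > 3/2` -/

/-- **LEVEL `5/3` (unconditional)** — the concrete clause offered for rev 12 of the K2 skeleton: for every profile of
the route's Type-I class, `∃ K ≥ 0, ∀ t < 0, ∀ R > 0, ∫_{B̄(0,R)}‖v(t)‖² ≤ K R^{5/3} (−t)^{−1/3}` (sheets, `∼ R²`, are
excluded; refuter1's three-sheet variant of the K-29 witness fails it). -/
theorem exists_level_five_thirds (hrate : HasTypeITimeDecay C v)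
    (hcont : ContinuousOn (uncurry v) (Iio (0 : ℝ) ×ˢ univ))
    (hmild : ∀ s t : ℝ, s < t → t < 0 → ∀ x,
      v t x = heatExtension (v s) (t - s) x - oseenDuhamel 1 s v v t x)
    (hdiv : ∀ t < 0, VectorCalculus.IsDivFree (v t)) :
    ∃ K : ℝ, 0 ≤ K ∧ ∀ t < 0, ∀ R : ℝ, 0 < R →
      ∫ x in closedBall (0 : EuclideanSpace ℝ (Fin 3)) R, ‖v t x‖ ^ 2 ≤ K * R ^ (5 / 3 : ℝ) * (-t) ^ (-(1 / 3 : ℝ)) := by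
  obtain ⟨K₂, hK₂0, h2⟩ := exists_levelTwo hrate hcont hmild hdiv
  obtain ⟨K', hK'0, h⟩ := levelStep hrate hcont hmild hdiv (α := 2) (by norm_num) (by norm_num) hK₂0 h2
  refine ⟨K', hK'0, fun t ht R hR => ?_⟩
  have := h t ht R hR
  norm_num at this
  exact this

/-- **THE LARGE-SCALE ENERGY BOOTSTRAP (unconditional): LEVEL `α` FOR EVERY `3/2 < α ≤ 3`.**  For every profile
of the route's Type-I class and every `α ∈ (3/2, 3]` there is `K ≥ 0` with
`∫_{B̄(0,R)} ‖v(t,x)‖² dx ≤ K · R^α · (−t)^{−(α−1)/2}` for all `t < 0`, `R > 0`.  (Iterate LEVEL `α ↦ 1 + α/3`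
from LEVEL `2` along `α_n = 3/2 + (1/2)·3^{−n}`, then monotonicity in `α` for `R ≥ √(−t)` and the Type-I rate for
`R ≤ √(−t)`.) -/
theorem exists_level_of_gt_three_halves (hrate : HasTypeITimeDecay C v)
    (hcont : ContinuousOn (uncurry v) (Iio (0 : ℝ) ×ˢ univ))
    (hmild : ∀ s t : ℝ, s < t → t < 0 → ∀ x,
      v t x = heatExtension (v s) (t - s) x - oseenDuhamel 1 s v v t x)
    (hdiv : ∀ t < 0, VectorCalculus.IsDivFree (v t)) {α : ℝ} (hα : 3 / 2 < α) (hα3 : α ≤ 3) :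
    ∃ K : ℝ, 0 ≤ K ∧ ∀ t < 0, ∀ R : ℝ, 0 < R →
      ∫ x in closedBall (0 : EuclideanSpace ℝ (Fin 3)) R, ‖v t x‖ ^ 2 ≤ K * R ^ α * (-t) ^ (-((α - 1) / 2)) := by
  have hC0 := typeI_const_nonneg hrate
  -- the levels `α_n = 3/2 + (1/2) 3^{-n}`
  have hseq : ∀ n : ℕ, ∃ K : ℝ, 0 ≤ K ∧ ∀ t < 0, ∀ R : ℝ, 0 < R →
      ∫ x in closedBall (0 : EuclideanSpace ℝ (Fin 3)) R, ‖v t x‖ ^ 2 ≤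
        K * R ^ ((3 / 2 : ℝ) + 1 / 2 * (1 / 3 : ℝ) ^ n) * (-t) ^ (-(((3 / 2 : ℝ) + 1 / 2 * (1 / 3 : ℝ) ^ n - 1) / 2)) := by
    intro n
    induction n with
    | zero =>
      have e : (3 / 2 : ℝ) + 1 / 2 * (1 / 3 : ℝ) ^ 0 = 2 := by norm_num
      rw [e]
      exact exists_levelTwo hrate hcont hmild hdiv
    | succ n ih =>
      obtain ⟨K, hK0, hK⟩ := ih
      have hlt : (1 : ℝ) < (3 / 2 : ℝ) + 1 / 2 * (1 / 3 : ℝ) ^ n := by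
        have : 0 ≤ (1 / 3 : ℝ) ^ n := by positivity
        linarith
      have hlt3 : (3 / 2 : ℝ) + 1 / 2 * (1 / 3 : ℝ) ^ n < 3 := by
        have : (1 / 3 : ℝ) ^ n ≤ 1 := pow_le_one₀ (by norm_num) (by norm_num)
        linarith
      have e : (3 / 2 : ℝ) + 1 / 2 * (1 / 3 : ℝ) ^ (n + 1) = 1 + ((3 / 2 : ℝ) + 1 / 2 * (1 / 3 : ℝ) ^ n) / 3 := by
        rw [pow_succ]; ring
      rw [e]
      exact levelStep hrate hcont hmild hdiv hlt hlt3 hK0 hK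
  -- choose `n` with `α_n ≤ α`
  obtain ⟨n, hn⟩ := exists_pow_lt_of_lt_one (by linarith : 0 < 2 * (α - 3 / 2)) (by norm_num : (1 / 3 : ℝ) < 1)
  have hαn : (3 / 2 : ℝ) + 1 / 2 * (1 / 3 : ℝ) ^ n ≤ α := by linarith
  obtain ⟨K, hK0, hK⟩ := hseq n
  set V₁ : ℝ := volume.real (closedBall (0 : EuclideanSpace ℝ (Fin 3)) 1) with hV₁
  have hV₁0 : 0 ≤ V₁ := measureReal_nonneg
  refine ⟨K + C ^ 2 * V₁, by positivity, fun t ht R hR => ?_⟩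
  have hX : 0 ≤ R ^ α * (-t) ^ (-((α - 1) / 2)) :=
    mul_nonneg (Real.rpow_nonneg hR.le _) (Real.rpow_nonneg (by linarith) _)
  rcases le_or_gt (Real.sqrt (-t)) R with hle | hlt
  · calc _ ≤ K * R ^ ((3 / 2 : ℝ) + 1 / 2 * (1 / 3 : ℝ) ^ n) *
          (-t) ^ (-(((3 / 2 : ℝ) + 1 / 2 * (1 / 3 : ℝ) ^ n - 1) / 2)) := hK t ht R hR
      _ ≤ K * R ^ α * (-t) ^ (-((α - 1) / 2)) := level_mono hK0 hαn ht hle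
      _ ≤ (K + C ^ 2 * V₁) * R ^ α * (-t) ^ (-((α - 1) / 2)) := by
          rw [mul_assoc, mul_assoc]; exact mul_le_mul_of_nonneg_right (by nlinarith) hX
  · have h := setIntegral_closedBall_norm_sq_le_of_small hrate hα3 ht hR hlt.le
    calc _ ≤ C ^ 2 * V₁ * R ^ α * (-t) ^ (-((α - 1) / 2)) := h
      _ ≤ (K + C ^ 2 * V₁) * R ^ α * (-t) ^ (-((α - 1) / 2)) := by
          rw [mul_assoc (K + _), mul_assoc (C ^ 2 * V₁)]; exact mul_le_mul_of_nonneg_right (by linarith) hX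

end Summit.NavierStokesRegularity.NavierStokesRegularity.Theorems.PoloidalWindowDoorPoloidalWindowRigidityLargeScaleEnergyBootstrapLevels

end
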